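import Summits.QuantumAdvantage.QuantumAdvantage.Theorems.SosSandwichPseudoBoundedAALevelKRungChebyshev
import Literature.Analysis.Approximation.MarkovCoefficientInequality
import HarnessLib

/-!
# Route `SosSandwich`, crux `PseudoBoundedAA` (stmt-QuantumAdvantage-15237): the level-`k` rung with
# V. A. Markov's sharp coefficient constant

Item (3) of the repair census of the level-`k` rung (evidence `RUNGS-15237.md`, `CHEBYSHEV-RUNG-15237.md`), now in
full: the sup norm of the level-`k` part of an `M`-bounded cube function of Fourier degree `≤ d` is at most
`M · τ_{d,k}`, `τ_{d,k} = max(|t_k^{(d)}|, |t_k^{(d-1)}|)` the larger `k`-th power-basis coefficient of the Chebyshev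
polynomials `T_d`, `T_{d-1}` — V. A. Markov's coefficient inequality (Rivlin 1974 Sect. 2.7 Remark 2 (2.44)–(2.45),
tree `Literature.Analysis.Approximation.MarkovCoefficientInequality`), applied to the noise polynomial
`P_s(t) = (T_{(1-t)/2} g)(s)` whose `k`-th coefficient is the level-`k` part at `s`.  This is SHARP as a statement
about coefficients of bounded polynomials (equality for `T_d`, `T_{d-1}`).  Consequences, through the parametric rung
`LevelKRungChebyshev.exists_influence_ge_levelK_of_supBound`:

* §1 `abs_levelK_sum_le_markov` — `|Σ_{|S|=k} ĝ(S) χ_S(s)| ≤ M · τ_{d,k}` (every `k`, every vertex `s`);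
  `max_abs_coeff_T_le` — `τ_{d,k} ≤ (2d)^k/k!` (tree `ChebyshevCoefficientBound.abs_coeff_T_le`).
* §2 `exists_influence_ge_levelK_markov` — for `0 ≤ p ≤ 1` of total degree `≤ d` on `{0,1}^N` and `k ≥ 1`:
  `∃ i, 16·W_k[p]² ≤ 9^{k-1}·(2k+1)²·τ_{d,k}²·Inf_i[p]`; `exists_influence_ge_levelK_markov'` — the monomial
  reading `16·(k!)²·W_k[p]² ≤ 9^{k-1}·(2k+1)²·(2d)^{2k}·Inf_i[p]`.  Tree so far: `16(k!)²W_k² ≤ 9^{k-1}(2k+1)² d^{4k-2}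
  Inf_i` (iterated Markov, `LevelKRung`) and `4(k!)²W_k² ≤ 9^{k-1}(2k+1)² d²(2d)^{2k} Inf_i` (weak Chebyshev form,
  `LevelKRungChebyshev`); the present constant removes the last factor `4d²` and is the best the sup-norm route
  gives at the coefficient step.
* §3 the same on `Q_T` and `K_T` (`d = 2T`): `16·(k!)²·W_k² ≤ 9^{k-1}(2k+1)²(4T)^{2k}·Inf_i`.

Honest label: support lemmas — constants of the general bottom rung only; the `9^{k-1}` Bonami factor and hence the
`T^{O(T)}` total over all levels are untouched, so the open content of the crux (`AA_Q` uniform in `T`) is not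
addressed.  No stub, crux or summit is proved.
Sources: Rivlin 1974 Sect. 2.7 Remark 2 (2.44)–(2.45), Sect. 1.5 (1.96); O'Donnell 2014 Thm. 9.21, §2.4;
Aaronson–Ambainis 2014 Conj. 6.
-/

-- D-0017: single-conjunct summit ⇒ the duplicate `QuantumAdvantage.QuantumAdvantage` is mandated.
set_option linter.dupNamespace false

noncomputable section

namespace Summit.QuantumAdvantage.QuantumAdvantage.Theorems.SosSandwich.LevelKRungMarkov

open Finset Polynomial Polynomial.Chebyshev
open Literature.Computability.QuantumComplexity
open Literature.Computability.Complexity.LowDegree (cubeFourierCoeff IsLevelLE)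
open Literature.Probability.RandomGraphs.LowDegree (walsh)
open Literature.Analysis.Approximation.MarkovCoefficientInequality (abs_coeff_le_mul_max_abs_coeff_T)
open Summit.QuantumAdvantage.QuantumAdvantage.Theorems.SosSandwich.LevelOneRung
open Summit.QuantumAdvantage.QuantumAdvantage.Theorems.SosSandwich.LevelTwoRung (coeff_noisePoly)
open Summit.QuantumAdvantage.QuantumAdvantage.Theorems.SosSandwich.LevelKRung
open Summit.QuantumAdvantage.QuantumAdvantage.Theorems.SosSandwich.ChebyshevCoefficientBound (abs_coeff_T_le)
open Summit.QuantumAdvantage.QuantumAdvantage.Theorems.SosSandwich.LevelKRungChebyshev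
  (exists_influence_ge_levelK_of_supBound)
open Literature.Computability.Cryptography (QQueryAlg)

variable {N : ℕ}

/-! ### §1 Sup norm of the level-`k` part: V. A. Markov's constant -/

/-- **Sup norm of the level-`k` part (V. A. Markov form).**  For an `M`-bounded `g : {0,1}^N → ℝ` of Fourier
degree `≤ d`, every `k` and every vertex `s`:
`|Σ_{|S|=k} ĝ(S) χ_S(s)| ≤ M · max(|t_k^{(d)}|, |t_k^{(d-1)}|)` — the sum is the `k`-th coefficient of the noise
polynomial `P_s`, of degree `≤ d` and `M`-bounded on `[-1, 1]`.
[cite: Rivlin1974, Sect. 2.7 Remark 2 (2.44)-(2.45)] [cite: ODonnell2014, §2.4] -/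
theorem abs_levelK_sum_le_markov {d : ℕ} {M : ℝ} {g : (Fin N → Bool) → ℝ} (hdeg : IsLevelLE d g)
    (hM : ∀ x, |g x| ≤ M) (k : ℕ) (s : Fin N → Bool) :
    |∑ S ∈ univ.filter (fun S : Finset (Fin N) => S.card = k), cubeFourierCoeff g S * walsh S s|
      ≤ M * max |(T ℝ d).coeff k| |(T ℝ (d - 1 : ℕ)).coeff k| := by
  rw [← coeff_noisePoly]
  exact abs_coeff_le_mul_max_abs_coeff_T
    (natDegree_le_iff_degree_le.mpr (degree_noisePoly_le hdeg s))
    (fun x hx => abs_eval_noisePoly_le hM s hx) k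

/-- `τ_{d,k} = max(|t_k^{(d)}|, |t_k^{(d-1)}|) ≤ (2d)^k / k!` for `k ≥ 1`. [cite: Rivlin1974, Sect. 1.5 (1.96)] -/
theorem max_abs_coeff_T_le (d : ℕ) {k : ℕ} (hk : 1 ≤ k) :
    max |(T ℝ d).coeff k| |(T ℝ (d - 1 : ℕ)).coeff k| ≤ (2 * (d : ℝ)) ^ k / (k.factorial : ℝ) := by
  refine max_le (abs_coeff_T_le d hk) ((abs_coeff_T_le (d - 1) hk).trans ?_)
  have h : ((d - 1 : ℕ) : ℝ) ≤ d := by exact_mod_cast Nat.sub_le d 1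
  gcongr

/-- `0 ≤ τ_{d,k}`. [folklore] -/
theorem max_abs_coeff_T_nonneg (d k : ℕ) : 0 ≤ max |(T ℝ d).coeff k| |(T ℝ (d - 1 : ℕ)).coeff k| :=
  (abs_nonneg _).trans (le_max_left _ _)

/-! ### §2 The level-`k` rung with V. A. Markov's constant -/

/-- **The level-`k` rung, V. A. Markov constant.**  For `k ≥ 1` and a real polynomial `p` of total degree `≤ d`
with `0 ≤ p ≤ 1` on `{0,1}^N`, `N ≥ 1`, some variable `i` has
`16·W_k[p]² ≤ 9^{k-1}·(2k+1)²·τ_{d,k}²·Inf_i[p]`, `W_k[p] = Σ_{|S|=k} p̂(S)²`,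
`τ_{d,k} = max(|t_k^{(d)}|, |t_k^{(d-1)}|)` (apply §1 to `p - 1/2`, `M = 1/2`, and the parametric rung).
[cite: Rivlin1974, Sect. 2.7 Remark 2 (2.44)-(2.45)] [cite: ODonnell2014, Thm. 9.21, §2.2]
[cite: AaronsonAmbainis2014, Conj. 6] -/
theorem exists_influence_ge_levelK_markov {d k : ℕ} (hk : 1 ≤ k) {p : MvPolynomial (Fin N) ℝ} (hN : 0 < N)
    (hp : p.totalDegree ≤ d) (hb : ∀ x, 0 ≤ evalBool p x ∧ evalBool p x ≤ 1) :
    ∃ i : Fin N, 16 *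
        (∑ S ∈ univ.filter (fun S : Finset (Fin N) => S.card = k), cubeFourierCoeff (evalBool p) S ^ 2) ^ 2 ≤
      (9 : ℝ) ^ (k - 1) * (2 * k + 1) ^ 2 * (max |(T ℝ d).coeff k| |(T ℝ (d - 1 : ℕ)).coeff k|) ^ 2 *
        influence i p := by
  classical
  have hM : ∀ x, |evalBool p x - 1 / 2| ≤ 1 / 2 := fun x => by
    rw [abs_le]; constructor <;> linarith [(hb x).1, (hb x).2]
  have hdeg : IsLevelLE d (fun x => evalBool p x - 1 / 2) := fun S hS => by
    have hS0 : S ≠ ∅ := by rintro rfl; simp at hS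
    rw [cubeFourierCoeff_sub_const _ hS0]
    exact cubeFourierCoeff_evalBool_eq_zero hp hS
  have hcoef : ∀ S : Finset (Fin N), S.card = k →
      cubeFourierCoeff (fun x => evalBool p x - 1 / 2) S = cubeFourierCoeff (evalBool p) S := by
    intro S hS
    refine cubeFourierCoeff_sub_const _ ?_
    rintro rfl; simp at hS; omega
  set τ : ℝ := max |(T ℝ d).coeff k| |(T ℝ (d - 1 : ℕ)).coeff k| with hτ
  have hLsup : ∀ z : Fin N → Bool,
      |∑ S ∈ univ.filter (fun S : Finset (Fin N) => S.card = k), cubeFourierCoeff (evalBool p) S * walsh S z|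
        ≤ 1 / 2 * τ := by
    intro z
    have h := abs_levelK_sum_le_markov hdeg hM k z
    have e : ∑ S ∈ univ.filter (fun S : Finset (Fin N) => S.card = k),
        cubeFourierCoeff (fun x => evalBool p x - 1 / 2) S * walsh S z =
        ∑ S ∈ univ.filter (fun S : Finset (Fin N) => S.card = k), cubeFourierCoeff (evalBool p) S * walsh S z :=
      Finset.sum_congr rfl fun S hS => by rw [hcoef S (Finset.mem_filter.mp hS).2]
    rwa [e] at h
  obtain ⟨i, hi⟩ := exists_influence_ge_levelK_of_supBound hk p hN hLsup
  refine ⟨i, ?_⟩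
  calc 16 * (∑ S ∈ univ.filter (fun S : Finset (Fin N) => S.card = k), cubeFourierCoeff (evalBool p) S ^ 2) ^ 2
      = 4 * (4 * (∑ S ∈ univ.filter (fun S : Finset (Fin N) => S.card = k),
          cubeFourierCoeff (evalBool p) S ^ 2) ^ 2) := by ring
    _ ≤ 4 * ((9 : ℝ) ^ (k - 1) * (2 * k + 1) ^ 2 * (1 / 2 * τ) ^ 2 * influence i p) :=
        mul_le_mul_of_nonneg_left hi (by norm_num)
    _ = (9 : ℝ) ^ (k - 1) * (2 * k + 1) ^ 2 * τ ^ 2 * influence i p := by ring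

/-- **The level-`k` rung, monomial reading of V. A. Markov's constant.**  Under the same hypotheses,
`16·(k!)²·W_k[p]² ≤ 9^{k-1}·(2k+1)²·(2d)^{2k}·Inf_i[p]` (`τ_{d,k} ≤ (2d)^k/k!`); compare the tree's
`16(k!)²W_k² ≤ 9^{k-1}(2k+1)² d^{4k-2} Inf_i` (`LevelKRung`) and `4(k!)²W_k² ≤ 9^{k-1}(2k+1)² d²(2d)^{2k} Inf_i`
(`LevelKRungChebyshev`).
[cite: Rivlin1974, Sect. 2.7 Remark 2 (2.44)-(2.45); Sect. 1.5 (1.96)] [cite: ODonnell2014, Thm. 9.21, §2.2]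
[cite: AaronsonAmbainis2014, Conj. 6] -/
theorem exists_influence_ge_levelK_markov' {d k : ℕ} (hk : 1 ≤ k) {p : MvPolynomial (Fin N) ℝ} (hN : 0 < N)
    (hp : p.totalDegree ≤ d) (hb : ∀ x, 0 ≤ evalBool p x ∧ evalBool p x ≤ 1) :
    ∃ i : Fin N, 16 * (k.factorial : ℝ) ^ 2 *
        (∑ S ∈ univ.filter (fun S : Finset (Fin N) => S.card = k), cubeFourierCoeff (evalBool p) S ^ 2) ^ 2 ≤
      (9 : ℝ) ^ (k - 1) * (2 * k + 1) ^ 2 * (2 * (d : ℝ)) ^ (2 * k) * influence i p := by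
  obtain ⟨i, hi⟩ := exists_influence_ge_levelK_markov hk hN hp hb
  refine ⟨i, ?_⟩
  set τ : ℝ := max |(T ℝ d).coeff k| |(T ℝ (d - 1 : ℕ)).coeff k| with hτ
  set W := ∑ S ∈ univ.filter (fun S : Finset (Fin N) => S.card = k), cubeFourierCoeff (evalBool p) S ^ 2 with hW
  have hfac : (0 : ℝ) < (k.factorial : ℝ) := by positivity
  have hτk : τ * (k.factorial : ℝ) ≤ (2 * (d : ℝ)) ^ k := by
    have := max_abs_coeff_T_le d hk
    rwa [le_div_iff₀ hfac] at this
  have hτk2 : (τ * (k.factorial : ℝ)) ^ 2 ≤ (2 * (d : ℝ)) ^ (2 * k) := by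
    rw [mul_comm 2 k, pow_mul]
    exact pow_le_pow_left₀ (mul_nonneg (max_abs_coeff_T_nonneg d k) hfac.le) hτk 2
  have hinf : 0 ≤ influence i p := influence_nonneg i p
  calc 16 * (k.factorial : ℝ) ^ 2 * W ^ 2 = (k.factorial : ℝ) ^ 2 * (16 * W ^ 2) := by ring
    _ ≤ (k.factorial : ℝ) ^ 2 * ((9 : ℝ) ^ (k - 1) * (2 * k + 1) ^ 2 * τ ^ 2 * influence i p) :=
        mul_le_mul_of_nonneg_left hi (by positivity)
    _ = (9 : ℝ) ^ (k - 1) * (2 * k + 1) ^ 2 * (τ * (k.factorial : ℝ)) ^ 2 * influence i p := by ring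
    _ ≤ (9 : ℝ) ^ (k - 1) * (2 * k + 1) ^ 2 * (2 * (d : ℝ)) ^ (2 * k) * influence i p := by
        gcongr

/-! ### §3 Consequences on `Q_T` and `K_T` (`d = 2T`) -/

/-- **The level-`k` rung on `Q_T`, V. A. Markov constant** (`d = 2T`): for a `T`-query quantum algorithm on
`N ≥ 1` bits and a real polynomial `p` with its acceptance probabilities as cube values, some variable has
`16·(k!)²·W_k[p]² ≤ 9^{k-1}·(2k+1)²·(4T)^{2k}·Inf_i[p]`.
[cite: BealsEtAl2001, Lemma 4.2] [cite: AaronsonAmbainis2014, Conj. 6]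
[cite: Rivlin1974, Sect. 2.7 Remark 2 (2.44)-(2.45)] -/
theorem exists_influence_ge_levelK_markov_query {k : ℕ} (hk : 1 ≤ k) (hN : 0 < N) (Q : QQueryAlg N)
    (p : MvPolynomial (Fin N) ℝ) (hp : ∀ x, evalBool p x = Q.acceptProb x) :
    ∃ i : Fin N, 16 * (k.factorial : ℝ) ^ 2 *
        (∑ S ∈ univ.filter (fun S : Finset (Fin N) => S.card = k), cubeFourierCoeff (evalBool p) S ^ 2) ^ 2 ≤
      (9 : ℝ) ^ (k - 1) * (2 * k + 1) ^ 2 * (2 * ((2 * Q.queries : ℕ) : ℝ)) ^ (2 * k) * influence i p := by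
  obtain ⟨p₀, hdeg, hval⟩ := exists_acceptPolynomial Q
  have heq : evalBool p = evalBool p₀ := funext fun x => by rw [hp x]; exact hval x
  have hb : ∀ x, 0 ≤ evalBool p₀ x ∧ evalBool p₀ x ≤ 1 := fun x => by
    have hx : evalBool p₀ x = Q.acceptProb x := (hval x).symm
    rw [hx]
    exact ⟨Q.acceptProb_nonneg x, Q.acceptProb_le_one' x⟩
  obtain ⟨i, hi⟩ := exists_influence_ge_levelK_markov' hk hN hdeg hb
  refine ⟨i, ?_⟩
  have hinf : influence i p = influence i p₀ := by unfold influence; rw [heq]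
  rw [heq, hinf]
  exact hi

/-- **The level-`k` rung on `K_T`, V. A. Markov constant** (`d = 2T`): for `p` pseudo-bounded of order `T`
(`p` and `1 - p` sums of squares of degree-`≤ T` polynomials on the cube) on `N ≥ 1` bits, some variable has
`16·(k!)²·W_k[p]² ≤ 9^{k-1}·(2k+1)²·(4T)^{2k}·Inf_i[p]`.
[cite: KaniewskiLeeDewolf2015, Def. 7] [cite: AaronsonAmbainis2014, Conj. 6]
[cite: Rivlin1974, Sect. 2.7 Remark 2 (2.44)-(2.45)] -/
theorem exists_influence_ge_levelK_markov_pseudoBounded {k T : ℕ} (hk : 1 ≤ k) (hN : 0 < N)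
    {p : MvPolynomial (Fin N) ℝ} (h : PseudoBounded T p) :
    ∃ i : Fin N, 16 * (k.factorial : ℝ) ^ 2 *
        (∑ S ∈ univ.filter (fun S : Finset (Fin N) => S.card = k), cubeFourierCoeff (evalBool p) S ^ 2) ^ 2 ≤
      (9 : ℝ) ^ (k - 1) * (2 * k + 1) ^ 2 * (2 * ((2 * T : ℕ) : ℝ)) ^ (2 * k) * influence i p := by
  obtain ⟨p', hdeg, hb, heq⟩ := exists_representative_of_pseudoBounded h
  obtain ⟨i, hi⟩ := exists_influence_ge_levelK_markov' hk hN hdeg hb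
  refine ⟨i, ?_⟩
  have hinf : influence i p' = influence i p := by unfold influence; rw [heq]
  rw [heq, hinf] at hi
  exact hi

end Summit.QuantumAdvantage.QuantumAdvantage.Theorems.SosSandwich.LevelKRungMarkov

end
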